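import Literature.AlgebraicGeometry.AbelianSchemes.PELTupleSpreadStageRows          -- ★ (mine) p848941∕p848968 GSPREAD-CORE⁺: the head with the three stage rows
import Literature.AlgebraicGeometry.AbelianSchemes.PELTupleSpreadStageNumberField   -- ★ p848341 number-field packaging (re-exports `IntegralModel` API used in §4)
import Literature.AlgebraicGeometry.Limits.LocalizationRelativeGeomConnectedSpread   -- ★ `isLocallyNoetherian_tensorObj_baseDiagram_left`
import HarnessLib

/-!
# GSPREAD-CORE⁺ readings: identified generic base, localised, pointwise, and over a number field — WITH the three stage rows

The four readings of ★ `exists_stage_pelTuple_of_generic_of_stageDuals` (★ `PELTupleSpreadStageOfStageDuals` §2: `…_of_iso_base_…`, `…_localise_…`,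
`…_pointwise_…`; ★ `PELTupleSpreadStageNumberField`: `IntegralModel.exists_stage_pelTuple_cofinite_of_stageDuals`) re-cut over the head⁺ ★
`exists_stage_pelTuple_rows_of_generic_of_stageDuals` (hole (H2) of the `stub_GSPREAD` assembly, crux hLiu418, road (S♭)): each takes, besides the binders of its
★ twin, the E-side Rosati row `hros₁` (side condition `r`) and a quasi-inverse `ν₁` of `λ₁` (`λ₁ ≫ ν₁ = [d]`), and returns, besides its ★ twin's conclusion, the
three STAGE rows of the stage tuple `(𝒜, ι, (Â, 𝒫), λ)` over `P ⊗ D(s)`: `IsCommMonObj 𝒜.X`, `∀ b b′, r b b′ → ι(b′) ≫ λ = λ ≫ ι(b)^∨`, `∃ ν, IsMonHom ν ∧ λ ≫ ν = [d]`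
(read at any `𝓨 → P ⊗ D(s)` by ★ `isCommMonObj_pullback_obj` ∕ `RingAction.rosati_row_baseChange` ∕ `exists_monHom_comp_eq_mulN_baseChange`).  The proofs are the
★ twins' proofs verbatim with the rows threaded: only the identified-generic-base reading touches them (the E-side rows are moved to `A₁ ×_Z (P ⊗ Spec K)` by ★
`rosati_row_baseChange`, ★ `isMonHom_baseChangeHom`, ★ `baseChangeHom_comp_eq_mulN`); the localised ∕ pointwise ∕ number-field readings re-read only the relation.

## What existed / was missing / was proved
* existed (★): the head⁺ `exists_stage_pelTuple_rows_of_generic_of_stageDuals`; the four ★ twins and every transport lemma they use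
  (`exists_tupleRel_baseChange_inv_of_iso`, `tupleRel_trans`, `exists_tupleRel_stage_baseChange_of_tupleRel_comp_whiskerLeft`,
  `exists_tupleRel_id_baseChange_of_tupleRel`, `IntegralModel.isProper_snd_specOver`, `eventually_nonempty_hom_specOver_valuationSubringAtPrime_baseDiagram`).
* missing, proved here (sorry-free): `exists_stage_pelTuple_rows_of_generic_of_iso_base_of_stageDuals` (§1), `…_rows_…_localise_of_stageDuals` (§2),
  `…_rows_…_pointwise_of_stageDuals` (§3), `IntegralModel.exists_stage_pelTuple_rows_cofinite_of_stageDuals` (§4).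
HONEST LABEL: HC_CM is proved only modulo the 2 remaining named inputs (hLiu418 24832, h413 24833) until rung 0 closes; generic, count-neutral,
`--supports stmt-HodgeConjecture-24832`.

## References
* [MumfordFogartyKirwan1994] D. Mumford, J. Fogarty, F. Kirwan, *Geometric Invariant Theory*, 3rd ed. (1994), Ch. 7 §2 Def. 7.2 (p. 129), §3 Prop. 7.3 (pp. 133–134).
* [MumfordAV1970] D. Mumford, *Abelian Varieties* (1970), §7 Thm. 4 (p. 72), §20 (Rosati involution).
* [RapoportSmithlingZhang2020Diagonal] M. Rapoport, B. Smithling, W. Zhang (2020), §3.2 (Rosati condition), §4.1 Thm. 4.1 (p. 17).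
* [Kottwitz1992] R. Kottwitz, *Points on some Shimura varieties over finite fields*, JAMS 5 (1992), §5 (pp. 389–391).
* [EGAIV3] A. Grothendieck, J. Dieudonné, *EGA IV₃* (1966), Thm. 8.8.2, (8.8.2.5), Thm. 8.10.5.
* [SerreTate1968] J.-P. Serre, J. Tate, *Good reduction of abelian varieties*, Ann. of Math. 88 (1968), §1.
-/

set_option autoImplicit false

noncomputable section

-- Mathlib's `Over`/pull-back API is stated across semireducible wrappers (as in the ★ `AbelianSchemes/*` files).
set_option backward.isDefEq.respectTransparency false

open CategoryTheory CategoryTheory.Limits AlgebraicGeometry MonoidalCategory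
open Literature.AlgebraicGeometry.Limits Literature.AlgebraicGeometry.Limits.LocApprox
open Literature.AlgebraicGeometry.Limits.OverFac (facObjIso)
open Literature.AlgebraicGeometry.Motives (SchemeOver specOver)

namespace Literature.AlgebraicGeometry.AbelianSchemes

namespace AbelianSchemeOver

section Readings

variable {A : Type} [CommRing A] [IsDomain A] [IsNoetherianRing A] (K : Type) [Field K] [CharZero K] [Algebra A K] [IsFractionRing A K]
  {P : SchemeOver A} [QuasiCompact P.hom] [QuasiSeparated P.hom] [LocallyOfFinitePresentation P.hom] [IsSeparated P.hom]
  [∀ s : Idx (nonZeroDivisors A), IsLocallyNoetherian (P ⊗ (baseDiagram (nonZeroDivisors A)).obj s).left]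
  [IsLocallyNoetherian (P ⊗ specOver A K).left] [IsReduced (P ⊗ specOver A K).left]

/-! ### §1 Over an identified generic base `e : Z ≅ P ⊗_A K` -/

/-- **GSPREAD-CORE⁺ OVER AN IDENTIFIED GENERIC BASE** (★ `exists_stage_pelTuple_of_generic_of_iso_base_of_stageDuals` with the three stage rows; the E-side rows are
moved to `A₁ ×_Z (P ⊗ Spec K)` by ★ `rosati_row_baseChange` ∕ `isMonHom_baseChangeHom` ∕ `baseChangeHom_comp_eq_mulN`, then the head⁺).
[cite: MumfordFogartyKirwan1994, Ch. 7 §2 Definition 7.2 (p. 129)] [cite: EGAIV3, Thm. 8.8.2 and Thm. 8.10.5] [cite: RapoportSmithlingZhang2020Diagonal, §3.2 and §4.1 Thm. 4.1 (p. 17)]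
[cite: MumfordAV1970, §7 Thm. 4 (p. 72)] [cite: Kottwitz1992, §5 (pp. 389–391)] -/
theorem exists_stage_pelTuple_rows_of_generic_of_iso_base_of_stageDuals (hP : IsProper (pullback.snd P.hom (specOver A K).hom))
    {O : Type*} [CommRing O] {m : ℕ} (bs : Module.Basis (Fin m) ℤ O) {g N : ℕ} [NeZero N] (hN : IsUnit ((N : ℕ) : K))
    {Z : Scheme.{0}} (e : Z ≅ (P ⊗ specOver A K).left)
    (A₁ : AbelianSchemeOver Z) (ρ₁ : RingAction O A₁) (D₁ : A₁.DualPair) (pol₁ : A₁.Polarization D₁)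
    (φ₁ : A₁.LevelStructure g N) (hg : A₁.IsOfRelDim g)
    (hdual : ∀ (t : Idx (nonZeroDivisors A)) (𝒜ₜ : AbelianSchemeOver (P ⊗ (baseDiagram (nonZeroDivisors A)).obj t).left)
      (G : A₁.X.left ⟶ 𝒜ₜ.X.left), A₁.IsBaseChangeVia 𝒜ₜ (e.hom ≫ (P ◁ (baseCone (nonZeroDivisors A) K).π.app t).left) G →
      ∃ (s : Idx (nonZeroDivisors A)) (σ : s ⟶ t), Nonempty (𝒜ₜ.baseChange (stageOver (nonZeroDivisors A) P σ).hom).DualPair)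
    (r : O → O → Prop)
    (hros₁ : ∀ b b' : O, r b b' → haveI := ρ₁.isMonHom b; ρ₁.i b' ≫ pol₁.lam = pol₁.lam ≫ DualPair.dualIsogenyOver (ρ₁.i b) D₁ D₁)
    (d : ℕ) (ν₁ : D₁.hat.X ⟶ A₁.X) [IsMonHom ν₁] (hν₁ : pol₁.lam ≫ ν₁ = A₁.mulN d) :
    ∃ (s : Idx (nonZeroDivisors A)) (𝒜 : AbelianSchemeOver (P ⊗ (baseDiagram (nonZeroDivisors A)).obj s).left) (ρ : RingAction O 𝒜)
      (D : 𝒜.DualPair) (pol : 𝒜.Polarization D) (φ : 𝒜.LevelStructure g N) (G : A₁.X.left ⟶ 𝒜.X.left) (Ĝ : D₁.hat.X.left ⟶ D.hat.X.left),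
      𝒜.IsOfRelDim g ∧ Flat (pullback.snd P.hom ((baseDiagram (nonZeroDivisors A)).obj s).hom) ∧
      (φ₁.IsBaseChangeVia φ (e.hom ≫ (P ◁ (baseCone (nonZeroDivisors A) K).π.app s).left) G ∧
        D₁.hat.IsBaseChangeVia D.hat (e.hom ≫ (P ◁ (baseCone (nonZeroDivisors A) K).π.app s).left) Ĝ ∧
        (∃ (wG : A₁.X.hom ≫ e.hom ≫ (P ◁ (baseCone (nonZeroDivisors A) K).π.app s).left = G ≫ 𝒜.X.hom)
            (wĜ : D₁.hat.X.hom ≫ e.hom ≫ (P ◁ (baseCone (nonZeroDivisors A) K).π.app s).left = Ĝ ≫ D.hat.X.hom),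
          Nonempty ((Scheme.Modules.pullback
            (pullback.map A₁.X.hom D₁.hat.X.hom 𝒜.X.hom D.hat.X.hom G Ĝ (e.hom ≫ (P ◁ (baseCone (nonZeroDivisors A) K).π.app s).left)
              wG wĜ)).obj D.P ≅ D₁.P)) ∧
        pol₁.lam.left ≫ Ĝ = G ≫ pol.lam.left ∧ ∀ a : O, (ρ₁.i a).left ≫ G = G ≫ (ρ.i a).left) ∧
      (IsCommMonObj 𝒜.X ∧
        (∀ b b' : O, r b b' → haveI := ρ.isMonHom b; ρ.i b' ≫ pol.lam = pol.lam ≫ DualPair.dualIsogenyOver (ρ.i b) D D) ∧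
        ∃ ν : D.hat.X ⟶ 𝒜.X, IsMonHom ν ∧ pol.lam ≫ ν = 𝒜.mulN d) := by
  obtain ⟨m₁, mh₁, he⟩ := exists_tupleRel_baseChange_inv_of_iso e A₁ ρ₁ D₁ pol₁ φ₁
  have hdual' : ∀ (t : Idx (nonZeroDivisors A)) (𝒜ₜ : AbelianSchemeOver (P ⊗ (baseDiagram (nonZeroDivisors A)).obj t).left)
      (G : (A₁.baseChange e.inv).X.left ⟶ 𝒜ₜ.X.left),
      (A₁.baseChange e.inv).IsBaseChangeVia 𝒜ₜ (P ◁ (baseCone (nonZeroDivisors A) K).π.app t).left G →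
      ∃ (s : Idx (nonZeroDivisors A)) (σ : s ⟶ t), Nonempty (𝒜ₜ.baseChange (stageOver (nonZeroDivisors A) P σ).hom).DualPair :=
    fun t 𝒜ₜ G h => hdual t 𝒜ₜ (m₁ ≫ G) (he.1.1.trans h)
  -- the E-side rows move to `A₁ ×_Z (P ⊗ Spec K)` (★ `rosati_row_baseChange`, ★ `isMonHom_baseChangeHom`, ★ `baseChangeHom_comp_eq_mulN`)
  haveI := isMonHom_baseChangeHom ν₁ e.inv
  obtain ⟨s, 𝒜, ρ, D, pol, φ, G, Ĝ, hg', hfl, hR, hrows⟩ := exists_stage_pelTuple_rows_of_generic_of_stageDuals K hP bs hN (A₁.baseChange e.inv)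
    (ρ₁.baseChange e.inv) (D₁.baseChange e.inv) (pol₁.baseChange e.inv) (φ₁.baseChange e.inv) (hg.baseChange _) hdual' r
    (RingAction.rosati_row_baseChange e.inv ρ₁ D₁ pol₁.lam r hros₁) d (baseChangeHom ν₁ e.inv) (baseChangeHom_comp_eq_mulN e.inv pol₁.lam ν₁ hν₁)
  exact ⟨s, 𝒜, ρ, D, pol, φ, m₁ ≫ G, mh₁ ≫ Ĝ, hg', hfl, tupleRel_trans he hR, hrows⟩

/-! ### §2 Localised -/

/-- **GSPREAD-CORE⁺ LOCALISED** (★ `exists_stage_pelTuple_of_generic_of_iso_base_localise_of_stageDuals` with the three stage rows, carried verbatim).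
[cite: EGAIV3, Thm. 8.8.2 and (8.8.2.5)] [cite: MumfordFogartyKirwan1994, Ch. 7 §2 Definition 7.2 (p. 129)] [cite: RapoportSmithlingZhang2020Diagonal, §3.2 and §4.1 Thm. 4.1 (p. 17)] -/
theorem exists_stage_pelTuple_rows_of_generic_of_iso_base_localise_of_stageDuals (hP : IsProper (pullback.snd P.hom (specOver A K).hom))
    {O : Type*} [CommRing O] {m : ℕ} (bs : Module.Basis (Fin m) ℤ O) {g N : ℕ} [NeZero N]
    (hN : IsUnit ((N : ℕ) : K)) {Z : Scheme.{0}} (e : Z ≅ (P ⊗ specOver A K).left)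
    (A₁ : AbelianSchemeOver Z) (ρ₁ : RingAction O A₁) (D₁ : A₁.DualPair) (pol₁ : A₁.Polarization D₁)
    (φ₁ : A₁.LevelStructure g N) (hg : A₁.IsOfRelDim g)
    (hdual : ∀ (t : Idx (nonZeroDivisors A)) (𝒜ₜ : AbelianSchemeOver (P ⊗ (baseDiagram (nonZeroDivisors A)).obj t).left)
      (G : A₁.X.left ⟶ 𝒜ₜ.X.left), A₁.IsBaseChangeVia 𝒜ₜ (e.hom ≫ (P ◁ (baseCone (nonZeroDivisors A) K).π.app t).left) G →
      ∃ (s : Idx (nonZeroDivisors A)) (σ : s ⟶ t), Nonempty (𝒜ₜ.baseChange (stageOver (nonZeroDivisors A) P σ).hom).DualPair)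
    (r : O → O → Prop)
    (hros₁ : ∀ b b' : O, r b b' → haveI := ρ₁.isMonHom b; ρ₁.i b' ≫ pol₁.lam = pol₁.lam ≫ DualPair.dualIsogenyOver (ρ₁.i b) D₁ D₁)
    (d : ℕ) (ν₁ : D₁.hat.X ⟶ A₁.X) [IsMonHom ν₁] (hν₁ : pol₁.lam ≫ ν₁ = A₁.mulN d) :
    ∃ (s : Idx (nonZeroDivisors A)) (𝒜 : AbelianSchemeOver (P ⊗ (baseDiagram (nonZeroDivisors A)).obj s).left) (ρ : RingAction O 𝒜)
      (D : 𝒜.DualPair) (pol : 𝒜.Polarization D) (φ : 𝒜.LevelStructure g N),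
      𝒜.IsOfRelDim g ∧ Flat (pullback.snd P.hom ((baseDiagram (nonZeroDivisors A)).obj s).hom) ∧
      (IsCommMonObj 𝒜.X ∧
        (∀ b b' : O, r b b' → haveI := ρ.isMonHom b; ρ.i b' ≫ pol.lam = pol.lam ≫ DualPair.dualIsogenyOver (ρ.i b) D D) ∧
        ∃ ν : D.hat.X ⟶ 𝒜.X, IsMonHom ν ∧ pol.lam ≫ ν = 𝒜.mulN d) ∧
      ∀ {T : Type} [CommRing T] [Algebra A T] (τ : specOver A T ⟶ (baseDiagram (nonZeroDivisors A)).obj s)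
        (κ : specOver A K ⟶ specOver A T),
        ∃ (G : A₁.X.left ⟶ (𝒜.baseChange (P ◁ τ).left).X.left) (Ĝ : D₁.hat.X.left ⟶ (D.baseChange (P ◁ τ).left).hat.X.left),
          φ₁.IsBaseChangeVia (φ.baseChange (P ◁ τ).left) (e.hom ≫ (P ◁ κ).left) G ∧
          D₁.hat.IsBaseChangeVia (D.baseChange (P ◁ τ).left).hat (e.hom ≫ (P ◁ κ).left) Ĝ ∧
          (∃ (wG : A₁.X.hom ≫ e.hom ≫ (P ◁ κ).left = G ≫ (𝒜.baseChange (P ◁ τ).left).X.hom)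
              (wĜ : D₁.hat.X.hom ≫ e.hom ≫ (P ◁ κ).left = Ĝ ≫ (D.baseChange (P ◁ τ).left).hat.X.hom),
            Nonempty ((Scheme.Modules.pullback
              (pullback.map A₁.X.hom D₁.hat.X.hom (𝒜.baseChange (P ◁ τ).left).X.hom (D.baseChange (P ◁ τ).left).hat.X.hom G Ĝ
                (e.hom ≫ (P ◁ κ).left) wG wĜ)).obj (D.baseChange (P ◁ τ).left).P ≅ D₁.P)) ∧
          pol₁.lam.left ≫ Ĝ = G ≫ (pol.baseChange (P ◁ τ).left).lam.left ∧
          ∀ a : O, (ρ₁.i a).left ≫ G = G ≫ (baseChangeHom (ρ.i a) (P ◁ τ).left).left := by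
  obtain ⟨s, 𝒜, ρ, D, pol, φ, G, Ĝ, hg', hfl, hR, hrows⟩ :=
    exists_stage_pelTuple_rows_of_generic_of_iso_base_of_stageDuals K hP bs hN e A₁ ρ₁ D₁ pol₁ φ₁ hg hdual r hros₁ d ν₁ hν₁
  refine ⟨s, 𝒜, ρ, D, pol, φ, hg', hfl, hrows, fun {T} _ _ τ κ => ?_⟩
  have hbase : e.hom ≫ (P ◁ (baseCone (nonZeroDivisors A) K).π.app s).left = (e.hom ≫ (P ◁ κ).left) ≫ (P ◁ τ).left := by
    rw [Category.assoc, whiskerLeft_left_comp_whiskerLeft_left_eq_leg (nonZeroDivisors A) K P s T τ κ]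
  obtain ⟨G', Ĝ', -, -, h⟩ := exists_tupleRel_stage_baseChange_of_tupleRel_comp_whiskerLeft (nonZeroDivisors A) P s T 𝒜 ρ D pol φ τ
    (e.hom ≫ (P ◁ κ).left) (tupleRel_congr_base hbase hR)
  exact ⟨G', Ĝ', h⟩

/-! ### §3 Localised and pointwise -/

/-- **GSPREAD-CORE⁺ LOCALISED AND POINTWISE** — the `gen_iso` clauses of the spread (★ `exists_stage_pelTuple_of_generic_of_iso_base_pointwise_of_stageDuals`) with
the three stage rows carried verbatim. [cite: MumfordFogartyKirwan1994, Ch. 7 §2 Definition 7.2 (p. 129)] [cite: EGAIV3, Thm. 8.8.2 and (8.8.2.5)]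
[cite: RapoportSmithlingZhang2020Diagonal, §3.2 and §4.1 Thm. 4.1 (p. 17)] -/
theorem exists_stage_pelTuple_rows_of_generic_of_iso_base_pointwise_of_stageDuals (hP : IsProper (pullback.snd P.hom (specOver A K).hom))
    {O : Type*} [CommRing O] {m : ℕ} (bs : Module.Basis (Fin m) ℤ O) {g N : ℕ} [NeZero N]
    (hN : IsUnit ((N : ℕ) : K)) {Z : Scheme.{0}} (e : Z ≅ (P ⊗ specOver A K).left)
    (A₁ : AbelianSchemeOver Z) (ρ₁ : RingAction O A₁) (D₁ : A₁.DualPair) (pol₁ : A₁.Polarization D₁)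
    (φ₁ : A₁.LevelStructure g N) (hg : A₁.IsOfRelDim g)
    (hdual : ∀ (t : Idx (nonZeroDivisors A)) (𝒜ₜ : AbelianSchemeOver (P ⊗ (baseDiagram (nonZeroDivisors A)).obj t).left)
      (G : A₁.X.left ⟶ 𝒜ₜ.X.left), A₁.IsBaseChangeVia 𝒜ₜ (e.hom ≫ (P ◁ (baseCone (nonZeroDivisors A) K).π.app t).left) G →
      ∃ (s : Idx (nonZeroDivisors A)) (σ : s ⟶ t), Nonempty (𝒜ₜ.baseChange (stageOver (nonZeroDivisors A) P σ).hom).DualPair)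
    (r : O → O → Prop)
    (hros₁ : ∀ b b' : O, r b b' → haveI := ρ₁.isMonHom b; ρ₁.i b' ≫ pol₁.lam = pol₁.lam ≫ DualPair.dualIsogenyOver (ρ₁.i b) D₁ D₁)
    (d : ℕ) (ν₁ : D₁.hat.X ⟶ A₁.X) [IsMonHom ν₁] (hν₁ : pol₁.lam ≫ ν₁ = A₁.mulN d) :
    ∃ (s : Idx (nonZeroDivisors A)) (𝒜 : AbelianSchemeOver (P ⊗ (baseDiagram (nonZeroDivisors A)).obj s).left) (ρ : RingAction O 𝒜)
      (D : 𝒜.DualPair) (pol : 𝒜.Polarization D) (φ : 𝒜.LevelStructure g N),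
      𝒜.IsOfRelDim g ∧ Flat (pullback.snd P.hom ((baseDiagram (nonZeroDivisors A)).obj s).hom) ∧
      (IsCommMonObj 𝒜.X ∧
        (∀ b b' : O, r b b' → haveI := ρ.isMonHom b; ρ.i b' ≫ pol.lam = pol.lam ≫ DualPair.dualIsogenyOver (ρ.i b) D D) ∧
        ∃ ν : D.hat.X ⟶ 𝒜.X, IsMonHom ν ∧ pol.lam ≫ ν = 𝒜.mulN d) ∧
      ∀ {T : Type} [CommRing T] [Algebra A T] (τ : specOver A T ⟶ (baseDiagram (nonZeroDivisors A)).obj s)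
        (κ : specOver A K ⟶ specOver A T) {T' : Scheme.{0}} (t : T' ⟶ Z),
        ∃ (H : ((((𝒜.baseChange (P ◁ τ).left).baseChange (e.hom ≫ (P ◁ κ).left)).baseChange t)).X.left ⟶ (A₁.baseChange t).X.left)
          (Ĥ : (((D.baseChange (P ◁ τ).left).baseChange (e.hom ≫ (P ◁ κ).left)).baseChange t).hat.X.left ⟶ (D₁.baseChange t).hat.X.left),
          (((φ.baseChange (P ◁ τ).left).baseChange (e.hom ≫ (P ◁ κ).left)).baseChange t).IsBaseChangeVia (φ₁.baseChange t) (𝟙 T') H ∧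
          (((D.baseChange (P ◁ τ).left).baseChange (e.hom ≫ (P ◁ κ).left)).baseChange t).hat.IsBaseChangeVia (D₁.baseChange t).hat (𝟙 T') Ĥ ∧
          (∃ (wG : (((𝒜.baseChange (P ◁ τ).left).baseChange (e.hom ≫ (P ◁ κ).left)).baseChange t).X.hom ≫ 𝟙 T' =
                H ≫ (A₁.baseChange t).X.hom)
              (wĜ : (((D.baseChange (P ◁ τ).left).baseChange (e.hom ≫ (P ◁ κ).left)).baseChange t).hat.X.hom ≫ 𝟙 T' =
                Ĥ ≫ (D₁.baseChange t).hat.X.hom),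
            Nonempty ((Scheme.Modules.pullback
              (pullback.map (((𝒜.baseChange (P ◁ τ).left).baseChange (e.hom ≫ (P ◁ κ).left)).baseChange t).X.hom
                (((D.baseChange (P ◁ τ).left).baseChange (e.hom ≫ (P ◁ κ).left)).baseChange t).hat.X.hom (A₁.baseChange t).X.hom
                (D₁.baseChange t).hat.X.hom H Ĥ (𝟙 T') wG wĜ)).obj (D₁.baseChange t).P ≅
              (((D.baseChange (P ◁ τ).left).baseChange (e.hom ≫ (P ◁ κ).left)).baseChange t).P)) ∧
          (((pol.baseChange (P ◁ τ).left).baseChange (e.hom ≫ (P ◁ κ).left)).baseChange t).lam.left ≫ Ĥ = H ≫ (pol₁.baseChange t).lam.left ∧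
          ∀ a : O, (baseChangeHom (baseChangeHom ((ρ.baseChange (P ◁ τ).left).i a) (e.hom ≫ (P ◁ κ).left)) t).left ≫ H =
            H ≫ (baseChangeHom (ρ₁.i a) t).left := by
  obtain ⟨s, 𝒜, ρ, D, pol, φ, hg', hfl, hrows, hloc⟩ :=
    exists_stage_pelTuple_rows_of_generic_of_iso_base_localise_of_stageDuals K hP bs hN e A₁ ρ₁ D₁ pol₁ φ₁ hg hdual r hros₁ d ν₁ hν₁
  refine ⟨s, 𝒜, ρ, D, pol, φ, hg', hfl, hrows, fun {T} _ _ τ κ {T'} t => ?_⟩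
  obtain ⟨G, Ĝ, h⟩ := hloc τ κ
  exact exists_tupleRel_id_baseChange_of_tupleRel ρ₁ D₁ pol₁ φ₁ (𝒜.baseChange (P ◁ τ).left) (ρ.baseChange (P ◁ τ).left)
    (D.baseChange (P ◁ τ).left) (pol.baseChange (P ◁ τ).left) (φ.baseChange (P ◁ τ).left) h t

end Readings

end AbelianSchemeOver

end Literature.AlgebraicGeometry.AbelianSchemes

/-! ### §4 Over a number field, cofinitely in `w` -/

namespace Literature.AlgebraicGeometry.Motives

namespace IntegralModel

open Literature.AlgebraicGeometry.AbelianSchemes Literature.AlgebraicGeometry.AbelianSchemes.AbelianSchemeOver IsDedekindDomain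
open scoped NumberField

section NumberField

variable {F : Type} [Field F] [NumberField F] {X : SchemeOver F} (𝓜 : IntegralModel (𝓞 F) F X)
  [QuasiCompact 𝓜.total.hom] [QuasiSeparated 𝓜.total.hom] [LocallyOfFinitePresentation 𝓜.total.hom] [IsSeparated 𝓜.total.hom]
  [IsProper X.hom] [IsLocallyNoetherian (𝓜.total ⊗ specOver (𝓞 F) F).left] [IsReduced (𝓜.total ⊗ specOver (𝓞 F) F).left]

/-- **GSPREAD-CORE⁺ OVER A NUMBER FIELD, COFINITELY IN `w`** (★ `IntegralModel.exists_stage_pelTuple_cofinite_of_stageDuals` with the three stage rows of the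
stage tuple `(𝒜, ι, (Â, 𝒫), λ)` over `𝓜.total ⊗ D(s)` — `IsCommMonObj`, Rosati for `r`, a quasi-inverse of exponent `d` — from the E-side rows `hros₁`, `hν₁`).
[cite: EGAIV3, Thm. 8.8.2, (8.8.2.5) and Thm. 8.10.5] [cite: MumfordFogartyKirwan1994, Ch. 7 §2 Definition 7.2 (p. 129) and §3 Proposition 7.3 (pp. 133–134)]
[cite: RapoportSmithlingZhang2020Diagonal, §3.2 and §4.1 Thm. 4.1 (p. 17)] [cite: MumfordAV1970, §7 Thm. 4 (p. 72)] [cite: Kottwitz1992, §5 (pp. 389–391)] [cite: SerreTate1968, §1] -/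
theorem exists_stage_pelTuple_rows_cofinite_of_stageDuals {O : Type*} [CommRing O] {m : ℕ} (bs : Module.Basis (Fin m) ℤ O) {g N : ℕ} [NeZero N]
    (A₁ : AbelianSchemeOver X.left) (ρ₁ : RingAction O A₁) (D₁ : A₁.DualPair) (pol₁ : A₁.Polarization D₁)
    (φ₁ : A₁.LevelStructure g N) (hg : A₁.IsOfRelDim g)
    (hdual : ∀ (t : Idx (nonZeroDivisors (𝓞 F))) (𝒜ₜ : AbelianSchemeOver (𝓜.total ⊗ (baseDiagram (nonZeroDivisors (𝓞 F))).obj t).left)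
      (G : A₁.X.left ⟶ 𝒜ₜ.X.left),
      A₁.IsBaseChangeVia 𝒜ₜ (𝓜.genericIso.inv.left ≫ (𝓜.total ◁ (baseCone (nonZeroDivisors (𝓞 F)) F).π.app t).left) G →
      ∃ (s : Idx (nonZeroDivisors (𝓞 F))) (σ : s ⟶ t), Nonempty (𝒜ₜ.baseChange (stageOver (nonZeroDivisors (𝓞 F)) 𝓜.total σ).hom).DualPair)
    (r : O → O → Prop)
    (hros₁ : ∀ b b' : O, r b b' → haveI := ρ₁.isMonHom b; ρ₁.i b' ≫ pol₁.lam = pol₁.lam ≫ DualPair.dualIsogenyOver (ρ₁.i b) D₁ D₁)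
    (d : ℕ) (ν₁ : D₁.hat.X ⟶ A₁.X) [IsMonHom ν₁] (hν₁ : pol₁.lam ≫ ν₁ = A₁.mulN d) :
    ∃ (s : Idx (nonZeroDivisors (𝓞 F))) (𝒜 : AbelianSchemeOver (𝓜.total ⊗ (baseDiagram (nonZeroDivisors (𝓞 F))).obj s).left)
      (ρ : RingAction O 𝒜) (D : 𝒜.DualPair) (pol : 𝒜.Polarization D) (φ : 𝒜.LevelStructure g N),
      𝒜.IsOfRelDim g ∧ Flat (pullback.snd 𝓜.total.hom ((baseDiagram (nonZeroDivisors (𝓞 F))).obj s).hom) ∧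
      (IsCommMonObj 𝒜.X ∧
        (∀ b b' : O, r b b' → haveI := ρ.isMonHom b; ρ.i b' ≫ pol.lam = pol.lam ≫ DualPair.dualIsogenyOver (ρ.i b) D D) ∧
        ∃ ν : D.hat.X ⟶ 𝒜.X, IsMonHom ν ∧ pol.lam ≫ ν = 𝒜.mulN d) ∧
      ∃ S : Set (HeightOneSpectrum (𝓞 F)), S.Finite ∧ ∀ w : HeightOneSpectrum (𝓞 F), w ∉ S →
        ∃ τ : specOver (𝓞 F) (HeightOneSpectrum.valuationSubringAtPrime F w) ⟶ (baseDiagram (nonZeroDivisors (𝓞 F))).obj s,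
        ∀ (κ : specOver (𝓞 F) F ⟶ specOver (𝓞 F) (HeightOneSpectrum.valuationSubringAtPrime F w)) {T' : Scheme.{0}} (t : T' ⟶ X.left),
    ∃ (H : ((((𝒜.baseChange (𝓜.total ◁ τ).left).baseChange (𝓜.genericIso.inv.left ≫ (𝓜.total ◁ κ).left)).baseChange t)).X.left ⟶ (A₁.baseChange t).X.left)
              (Ĥ : (((D.baseChange (𝓜.total ◁ τ).left).baseChange (𝓜.genericIso.inv.left ≫ (𝓜.total ◁ κ).left)).baseChange t).hat.X.left ⟶ (D₁.baseChange t).hat.X.left),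
              (((φ.baseChange (𝓜.total ◁ τ).left).baseChange (𝓜.genericIso.inv.left ≫ (𝓜.total ◁ κ).left)).baseChange t).IsBaseChangeVia (φ₁.baseChange t) (𝟙 T') H ∧
              (((D.baseChange (𝓜.total ◁ τ).left).baseChange (𝓜.genericIso.inv.left ≫ (𝓜.total ◁ κ).left)).baseChange t).hat.IsBaseChangeVia (D₁.baseChange t).hat (𝟙 T') Ĥ ∧
              (∃ (wG : (((𝒜.baseChange (𝓜.total ◁ τ).left).baseChange (𝓜.genericIso.inv.left ≫ (𝓜.total ◁ κ).left)).baseChange t).X.hom ≫ 𝟙 T' =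
                    H ≫ (A₁.baseChange t).X.hom)
                  (wĜ : (((D.baseChange (𝓜.total ◁ τ).left).baseChange (𝓜.genericIso.inv.left ≫ (𝓜.total ◁ κ).left)).baseChange t).hat.X.hom ≫ 𝟙 T' =
                    Ĥ ≫ (D₁.baseChange t).hat.X.hom),
                Nonempty ((Scheme.Modules.pullback
                  (pullback.map (((𝒜.baseChange (𝓜.total ◁ τ).left).baseChange (𝓜.genericIso.inv.left ≫ (𝓜.total ◁ κ).left)).baseChange t).X.hom
                    (((D.baseChange (𝓜.total ◁ τ).left).baseChange (𝓜.genericIso.inv.left ≫ (𝓜.total ◁ κ).left)).baseChange t).hat.X.hom (A₁.baseChange t).X.hom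
                    (D₁.baseChange t).hat.X.hom H Ĥ (𝟙 T') wG wĜ)).obj (D₁.baseChange t).P ≅
                  (((D.baseChange (𝓜.total ◁ τ).left).baseChange (𝓜.genericIso.inv.left ≫ (𝓜.total ◁ κ).left)).baseChange t).P)) ∧
              (((pol.baseChange (𝓜.total ◁ τ).left).baseChange (𝓜.genericIso.inv.left ≫ (𝓜.total ◁ κ).left)).baseChange t).lam.left ≫ Ĥ = H ≫ (pol₁.baseChange t).lam.left ∧
              ∀ a : O, (AbelianSchemeOver.baseChangeHom (AbelianSchemeOver.baseChangeHom ((ρ.baseChange (𝓜.total ◁ τ).left).i a) (𝓜.genericIso.inv.left ≫ (𝓜.total ◁ κ).left)) t).left ≫ H =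
                H ≫ (AbelianSchemeOver.baseChangeHom (ρ₁.i a) t).left := by
  classical
  haveI : ∀ s : Idx (nonZeroDivisors (𝓞 F)), IsLocallyNoetherian (𝓜.total ⊗ (baseDiagram (nonZeroDivisors (𝓞 F))).obj s).left :=
    fun s => isLocallyNoetherian_tensorObj_baseDiagram_left 𝓜.total s
  have hN : IsUnit ((N : ℕ) : F) := (Nat.cast_ne_zero.mpr (NeZero.ne N)).isUnit
  obtain ⟨s, 𝒜, ρ, D, pol, φ, hg', hfl, hrows, hpt⟩ := exists_stage_pelTuple_rows_of_generic_of_iso_base_pointwise_of_stageDuals F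
    𝓜.isProper_snd_specOver bs hN ((Over.forget _).mapIso 𝓜.genericIso).symm A₁ ρ₁ D₁ pol₁ φ₁ hg hdual r hros₁ d ν₁ hν₁
  refine ⟨s, 𝒜, ρ, D, pol, φ, hg', hfl, hrows,
    {w | ¬ Nonempty (specOver (𝓞 F) (HeightOneSpectrum.valuationSubringAtPrime F w) ⟶ (baseDiagram (nonZeroDivisors (𝓞 F))).obj s)},
    (Literature.AlgebraicGeometry.AbelianSchemes.eventually_nonempty_hom_specOver_valuationSubringAtPrime_baseDiagram s), fun w hw => ?_⟩
  obtain ⟨τ⟩ := not_not.mp hw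
  exact ⟨τ, fun κ {T'} t => hpt τ κ t⟩

end NumberField

end IntegralModel

end Literature.AlgebraicGeometry.Motives

end
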